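import Literature.MathematicalPhysics.QuantumFieldTheory.Balaban1983to89.B14RelBoundary
import Summits.QuantumFields.YangMills.Theorems.BalabanUVNodesN11Thm2RSideAtRecord13CoPH
import Summits.QuantumFields.YangMills.Theorems.BalabanUVNodesN11Thm2BSideAtRecord13CoPH
import Summits.QuantumFields.YangMills.Theorems.BalabanUVNodesN11Thm2CubeCountAtRecord13CoPH

/-!
# DAG node N11 — [III] THEOREM 2's 𝐁-SIDE (2.47)–(2.48) AT THE ₁₃ OBJECTS FROM THE INDUCTIVE BOUND (2.42) ALONE, BY RING ANCHORING
# (print p. 263: «Bounds for the boundary terms (2.40) are even more elementary. We use the exponential factor … from the inequality (2.42) to control the sum over X in (2.41)»)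

Cell `pub-ymgap`, YM-PLAN Track A (HUMAN RULING D-0062 ∕ D-0149), seat `pub-ymgap-dag-n11-w2` (g0), route `BalabanUVNodes`, key item K1⁷ `StabilityBAtRecordR13SepCoPH` =
stmt-QuantumFields-20542 (helper, count-neutral).  Companion of this seat's files 1 (`…Thm2Ineq249AtRecord13CoPH`, binder `h248`) and 5 (`…Thm2BSideAtRecord13CoPH`:
(2.47) PER CLASS ⇒ `h248`).  [III] = [Balaban1988Convergent], [II] = [Balaban1988RG2Cluster], [I] = [Balaban1987RG1].

WHY THIS FILE.  Of the four §-level sentences the (2.49) capstones of this seat display (𝐄-side (3.67) per point, 𝐑-side p. 283 per domain, 𝐁-side (2.47) per class, the vacuum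
sentence), the 𝐁-side one is NOT analysis: print derives (2.47)–(2.48) from the INDUCTIVE HYPOTHESIS (2.42) `|𝐁^{(j)}(X,…)| < B₀ exp(−κ d_j(X))` and the geometry of the (2.41)(i)
range «X ∩ Ω_j ≠ ∅ and X ∩ Z_j^∼ ≠ ∅».  The cell's `B14.RelBoundary` (unit b2b-b01) typed the mechanism over abstract carriers — RING ANCHORING: every admissible `X` carries an
anchor cube in a finite ring, termwise (2.42) and the anchored tree-graph summability (1.26) give `|𝐁^{(j)}| ≤ B₀·K·#ring_j` (`ringBound`), hence (2.47) in the DIAGONAL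
decomposition and (2.48) — leaving the EXISTENCE OF THE ANCHORS (cell GAPS C-b01-J1, hypotheses H1–H2) untyped («the cube geometry behind H1–H2 … DIVERGENCE F5»).  AT NODE 00's
RECORD the localization domains ARE the torus catalogue `Sect2.domSys = TreeLengthTorus.tsys` — non-empty WALL-CONNECTED families of `M`-cubes of `T^{(j)}` — and (1.26) is the
THEOREM `ineq126_torus`; THIS FILE PROVES THE ANCHOR EXISTENCE there by a first-exit argument along a wall-connected chain, and so derives file 1's binder `h248` from (2.42)
TERMWISE at the record's 𝐁-terms `t.B j X` — the 𝐁-side input of the (2.49) capstones DOWNGRADED from a Theorem-2-proof sentence to r11's inductive hypothesis (2.42) (the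
clause `Step.LFHyp.boundB` that the 𝐓-step supply chains of this node accumulate by `Step.lfHyp_all_of_steps`).

THE ANCHOR (what replaces H1–H2).  Write `□_c` for the sites of the `M`-cube `c` of `T^{(j)}` (`Sect2.domSites … (cubeDom c)`), `E_j := Z_j^∼ = enlT (MR_j) 1 (Λ_j)ᶜ`
(the set of the (2.41)(i) range as def-T's `Sect2.admB` reads it).  If `X ∈ 𝐃_j` meets `Ω_j` and `E_j`, take a cube `a` of `X` meeting `Ω_j`; either `□_a` meets `E_j` (anchor
`a`, witness `a`), or follow a wall-connected chain inside `X` from `a` to a cube meeting `E_j`: its FIRST cube `v` meeting `E_j` has a predecessor `u ∈ X`, `TAdj u v`, with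
`□_u ∩ E_j = ∅`, whence `□_u ⊆ Λ_j ⊆ Ω_j` (`Λ_jᶜ ⊆ E_j`, (2.1) `Λ_j ⊆ Ω_j`) and `□_u ≠ ∅` — so `v` lies in the RING
`ring_j(s) := {c : □_c ∩ E_j ≠ ∅ ∧ ∃ c′ (c′ = c ∨ TAdj c′ c), □_{c′} ∩ Ω_j(s) ≠ ∅}` (a finite set of cube indices, written out in the statements — no `def`).  Its cardinality
`#ring_j(s)` is the HONEST volume the 𝐁-side costs at the record: print's `|Γ_j|` in (2.47) presupposes the boundary separations of (2.3) p. 255 («the distance between their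
boundaries is at least 2MR_j»), which the record's admissibility `Chain21` (Ω_{j+1} ⊆ Λ_j ⊆ Ω_j only) does not carry — LOCATED, not repaired: the capstone user takes
`Γ_n ≥ #ring_n(s)` (displayed hypothesis `hΓ`).

WHAT THIS FILE PROVES (0 `sorry`, 0 `def`, standard axioms; count-neutral; nothing of Bałaban's asserted — (2.42) termwise is a HYPOTHESIS, displayed).
§1 generic over a torus catalogue `tsys d Nc`: `exists_exit_of_tLinked` (first exit of a wall-connected chain out of a predicate) · ★ `exists_anchor` (the anchor of a domain meeting
two cube-predicates one of which holds off the other) · ★ `admSum_abs_le_ringCard` (termwise decay bound + anchors in a ring + (1.26) torus ⇒ `|Σ_X adm·B(X)| ≤ B₀·K₀(4·2^d,2d)·#ring`,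
through `B14.RelBoundary.ringBound`).
§2 at the torus of record (`P : Params`): `exists_cube_of_domSites_inter_nonempty` · `subset_enlT` (`Y ⊆ Y^{∼n}`) · `domCube_nonempty` · ★★ `exists_anchor_of_admB` (H1–H2 of GAPS
C-b01-J1 PROVED for def-T's (2.41)(i) range `Sect2.admB`, given `Λ_j ⊆ Ω_j`, `j ≤ m + K`, `1 ≤ M`).
§3 at the ₁₃ objects: ★★ `bScale_abs_le_ringCard_of_ineq242` ((2.42) termwise at scale `j` ⇒ `|Σ_X admB·Re 𝐁^{(j)}(X,U,A)| ≤ B₀·K₀·#ring_j(s)` — (2.47) diagonal) ·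
★★★ `h248_at_record₁₃CoPH_of_ineq242` ((2.42) termwise, `j = 1,…,k`, and `#ring_n(s) ≤ Γ_n` ⇒ file 1's binder `h248`: `|B240 …| ≤ 2(B₀K₀)·Σ_{n=1}^{k} Γ_n`, through file 5's
`h248_at_record₁₃CoPH_of_ineq247` with the diagonal class map).

HONEST FRAMING.  Count-neutral kernel bookkeeping + finite combinatorics; (2.42) at the configuration is DISPLAYED (whether `(ιU, 0)` lies in the space `spaceB` where the
inductive hypothesis grants it is the supplier's clause, not read here); N11 NOT discharged; K1⁷ NOT closed; counts unmoved (typed 28∕28 · discharged 5∕27).  One finite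
four-torus programme at fixed `ε = L^{−K}`; R4 closes only the CONDITIONAL rung `BalabanLadder.UV`; NOT ℝ⁴, NOT OS, NOT the Yang–Mills mass gap (Clay), which none of this proves.

Sources: [Balaban1988Convergent] (2.40)–(2.42) p.261, (2.47)–(2.48) pp.263–264, (2.1)–(2.3) pp.254–255, p.262 (alternative inductive assumptions); [Balaban1988RG2Cluster] (1.26)
p.8; [Balaban1987RG1] p.257 (localization domains, wall-connected families).
-/

noncomputable section

open scoped BigOperators Matrix.Norms.L2Operator

namespace Summit.QuantumFields.YangMills.Theorems.BalabanUVNodesN11Thm2BSideOfIneq242AtRecord13CoPH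

open Literature.MathematicalPhysics.QuantumFieldTheory.Balaban1983to89 Step B14.Eq225Concrete B14Thm2 B12TreeDecay TreeLengthTorus Finset
open T4Continuum Node00
open B14.Eq213MaximalDomains (side)
open B10Eq38TorusDomains (toFine)
open B15Eq112TorusCover (cover cover_surjective)
open B14DomainGeom (subset_enl)
open BalabanUVNodesN11Thm2CubeCountAtRecord13CoPH (exists_site_in_domCube)
open BalabanUVNodesN11Thm2BSideAtRecord13CoPH (h248_at_record₁₃CoPH_of_ineq247)

/-! ## §1. Generic over a torus catalogue `tsys d Nc`: first exit, anchors, the ring bound -/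

section Generic

variable {d Nc : ℕ} [NeZero Nc]

omit [NeZero Nc] in
/-- **First exit.** Along a wall-connected chain inside `S` from a cube where `Q` fails to a cube where `Q` holds there are two consecutive cubes `u, v ∈ S`, `TAdj u v`, with
`¬Q u` and `Q v`. [folklore] -/
theorem exists_exit_of_tLinked {S : Finset (TPt d Nc)} {Q : TPt d Nc → Prop} {a b : TPt d Nc} (h : TLinked S a b) (ha : ¬ Q a) (hb : Q b) :
    ∃ u v, u ∈ S ∧ v ∈ S ∧ TAdj u v ∧ ¬ Q u ∧ Q v := by
  unfold TLinked at h
  induction h with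
  | refl => exact absurd hb ha
  | @tail b' c _ hstep ih =>
    by_cases hQ : Q b'
    · exact ih hQ
    · exact ⟨b', c, hstep.1, hstep.2.1, hstep.2.2, hQ, hb⟩

/-- **★ The anchor of a localization domain.** If the wall-connected domain `X ∈ 𝐃_j` has a cube satisfying `mΩ` and a cube satisfying `mE`, and every cube failing `mE`
satisfies `mΩ`, then `X` has a cube `c` with `mE c` which either satisfies `mΩ` itself or is wall-adjacent to a cube satisfying `mΩ` (first exit along a chain from the
`mΩ`-cube to the `mE`-cube). [cite: Balaban1987RG1, p.257 (wall-connected families); Balaban1988Convergent, (2.41)(i) p.261] -/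
theorem exists_anchor (X : (tsys d Nc).Dom) (mΩ mE : TPt d Nc → Prop) (hΩ : ∃ a ∈ X.1, mΩ a) (hE : ∃ b ∈ X.1, mE b)
    (hcompl : ∀ c, ¬ mE c → mΩ c) : ∃ c ∈ X.1, mE c ∧ ∃ c', (c' = c ∨ TAdj c' c) ∧ mΩ c' := by
  obtain ⟨a, ha, haΩ⟩ := hΩ
  by_cases haE : mE a
  · exact ⟨a, ha, haE, a, Or.inl rfl, haΩ⟩
  obtain ⟨b, hb, hbE⟩ := hE
  obtain ⟨u, v, _, hv, huv, huE, hvE⟩ := exists_exit_of_tLinked (X.2.2 a ha b hb) haE hbE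
  exact ⟨v, hv, hvE, u, Or.inr huv, hcompl u huE⟩

/-- **★ The per-scale RING BOUND on the torus** ((2.47) in the diagonal decomposition, the mechanism of p. 263 bottom made a theorem): termwise `|B(X)| ≤ B₀ e^{−κ d_j(X)}` on the
admissible `X` ((2.42) at one configuration), an anchor cube of every admissible `X` in the finite set `ring`, and [II] (1.26) ON THE TORUS (`ineq126_torus`, `κ ≥ κ₀(4·2^d, 2d)`) give
`|Σ_X adm·B(X)| ≤ B₀·K₀(4·2^d, 2d)·#ring` — `B14.RelBoundary.ringBound` at the concrete cube system `tcubeSys`. [cite: Balaban1988Convergent, (2.42) p.261, (2.47) p.264; Balaban1988RG2Cluster, (1.26) p.8] -/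
theorem admSum_abs_le_ringCard (B : (tsys d Nc).Dom → ℝ) (adm : (tsys d Nc).Dom → Bool) (ring : Finset (TPt d Nc))
    (hanchor : ∀ X, adm X = true → ∃ c ∈ X.1, c ∈ ring) {κ B₀ : ℝ} (hκ : kappa₀ (4 * 2 ^ d) (2 * d) ≤ κ) (hB₀ : 0 ≤ B₀)
    (hterm : ∀ X, adm X = true → |B X| ≤ B₀ * Real.exp (-κ * (tsys d Nc).dj X)) :
    |∑ X, (if adm X then B X else 0)| ≤ B₀ * K₀ (4 * 2 ^ d) (2 * d) * ring.card := by
  classical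
  rw [← Finset.sum_filter]
  have hanchor' : ∀ X ∈ (univ.filter fun X : (tsys d Nc).Dom => adm X = true), ∃ c ∈ X.1, c ∈ ring :=
    fun X hX => hanchor X (Finset.mem_filter.1 hX).2
  choose! anchor hanchorX hanchorR using hanchor'
  have h := B14.RelBoundary.ringBound (univ.filter fun X : (tsys d Nc).Dom => adm X = true) ring (tcubeSys d Nc).above anchor B
    (fun X => Real.exp (-κ * (tsys d Nc).dj X)) B₀ (K₀ (4 * 2 ^ d) (2 * d)) hB₀ (fun X => (Real.exp_pos _).le)
    (fun X hX => by rw [Real.norm_eq_abs]; exact hterm X (Finset.mem_filter.1 hX).2) hanchorR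
    (fun X hX => by rw [CubeSystem.mem_above, tcubeSys_cubes]; exact hanchorX X hX)
    (fun c _ => ineq126_torus d Nc hκ c)
  rwa [Real.norm_eq_abs] at h

end Generic

/-! ## §2. At the torus of record: cubes of a domain, `Y ⊆ Y^{∼n}`, non-empty cubes, the anchor of the (2.41)(i) range -/

section Torus

variable {P : Params}

/-- If the sites of `X ∈ 𝐃_j` meet `S` then some cube of `X` meets `S` (`domSites X` is the union of the cubes of `X`). [cite: Balaban1987RG1, p.257 (bookkeeping)] -/
theorem exists_cube_of_domSites_inter_nonempty {M j : ℕ} (X : (Sect2.domSys P M j).Dom) {S : Set (Site P 0)}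
    (h : (Sect2.domSites P M j X ∩ S).Nonempty) :
    ∃ c ∈ X.1, (Sect2.domSites P M j (Sect2.cubeDom P M j c) ∩ S).Nonempty := by
  obtain ⟨y, hyX, hyS⟩ := h
  unfold Sect2.domSites at hyX
  rw [Set.mem_iUnion₂] at hyX
  obtain ⟨c, hc, hyc⟩ := hyX
  exact ⟨c, hc, y, by rw [Sect2.domSites_cubeDom]; exact hyc, hyS⟩

/-- `Y ⊆ Y^{∼n}` on the torus (`enlT`: pull back to the cover, enlarge, push forward; the cover is onto). [cite: Balaban1988Convergent, (2.1)–(2.3) pp.254–255 (bookkeeping)] -/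
theorem subset_enlT (s n : ℕ) (Y : Set (Site P 0)) : Y ⊆ Sect2.enlT P s n Y := by
  intro y hy
  obtain ⟨q, hq⟩ := cover_surjective (P := P) y
  refine ⟨q, subset_enl s n _ ?_, hq⟩
  rw [Set.mem_preimage, hq]
  exact hy

/-- Every `M`-cube of `T^{(j)}` has a site (`j ≤ m + K`, `1 ≤ M`; file 10's `exists_site_in_domCube`). [cite: Balaban1987RG1, p.257 (the cubes π_j; bookkeeping)] -/
theorem domCube_nonempty {j M : ℕ} (hj : j ≤ P.m + P.K) (hM : 1 ≤ M) (c : TPt P.d (Sect2.domCount P M j)) :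
    (Sect2.domSites P M j (Sect2.cubeDom P M j c)).Nonempty := by
  obtain ⟨ι, -, hι⟩ := exists_site_in_domCube (P := P) hj hM
  exact ⟨toFine j (ι c), by rw [Sect2.domSites_cubeDom]; exact hι c⟩

/-- **★★ THE ANCHOR OF THE (2.41)(i) RANGE** (hypotheses H1–H2 of cell GAPS C-b01-J1 PROVED at def-T's objects): if `X ∈ 𝐃_j` is admissible for (2.41)(i) — its sites meet `Ω_j`
and `E_j = Z_j^∼ = (Λ_jᶜ)^{∼1}` — and `Λ_j ⊆ Ω_j` ((2.1)), then `X` has a cube `c` whose sites meet `E_j` and which is, or is wall-adjacent to, a cube whose sites meet `Ω_j`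
(`j ≤ m + K`, `1 ≤ M`: cubes are non-empty; a cube missing `E_j` lies in `Λ_j ⊆ Ω_j` since `Λ_jᶜ ⊆ E_j`). [cite: Balaban1988Convergent, (2.41)(i) p.261, (2.1)–(2.3) pp.254–255; Balaban1987RG1, p.257] -/
theorem exists_anchor_of_admB (ν : Stage7Numerics) {M j : ℕ} (g : ℕ → ℝ) (Ω Λ : ℕ → Set (Site P 0)) (hj : j ≤ P.m + P.K) (hM : 1 ≤ M)
    (hΛΩ : Λ j ⊆ Ω j) (X : (Sect2.domSys P M j).Dom) (h : Sect2.admB P ν M g Ω Λ j (Sect2.domSites P M j X) = true) :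
    ∃ c ∈ X.1, (Sect2.domSites P M j (Sect2.cubeDom P M j c) ∩ Sect2.enlT P (Sect2.zSide P ν M g j) 1 (Λ j)ᶜ).Nonempty ∧
      ∃ c', (c' = c ∨ TAdj c' c) ∧ (Sect2.domSites P M j (Sect2.cubeDom P M j c') ∩ Ω j).Nonempty := by
  rw [Sect2.admB_eq_true_iff] at h
  obtain ⟨hΩ, hE⟩ := h
  refine exists_anchor (d := P.d) (Nc := Sect2.domCount P M j) X
    (fun c => (Sect2.domSites P M j (Sect2.cubeDom P M j c) ∩ Ω j).Nonempty)
    (fun c => (Sect2.domSites P M j (Sect2.cubeDom P M j c) ∩ Sect2.enlT P (Sect2.zSide P ν M g j) 1 (Λ j)ᶜ).Nonempty)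
    (exists_cube_of_domSites_inter_nonempty X hΩ) (exists_cube_of_domSites_inter_nonempty X hE) ?_
  intro c hc
  obtain ⟨y, hy⟩ := domCube_nonempty hj hM c
  refine ⟨y, hy, hΛΩ ?_⟩
  by_contra hyΛ
  exact hc ⟨y, hy, subset_enlT (Sect2.zSide P ν M g j) 1 (Λ j)ᶜ hyΛ⟩

end Torus

/-! ## §3. At NODE 00's Stage-13 objects: (2.42) termwise ⇒ the diagonal (2.47) ⇒ file 1's binder `h248` -/

section AtRecord13

variable {F : T4Family} {N : ℕ} [NeZero N]
variable (θ : Stage13HParams F N) (p : B12.RunParams) {k : ℕ}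

open Classical in
/-- **★★ (2.47) DIAGONAL AT SCALE `j` FROM (2.42) TERMWISE**: for the history `s`, the witness `t` (its 𝐁-terms `t.B j X` over `𝐃_j` of record), the `S`-data `a`, the configuration
`U` and `1 ≤ j ≤ k`, `j ≤ m + K`, `1 ≤ M`: IF every `X` of the (2.41)(i) range obeys (2.42) `|Re 𝐁^{(j)}(X,(ιU,0),A)| ≤ B₀ e^{−κ d_j(X)}` with `κ ≥ κ₀(4·2^d, 2d)`, THEN
`|Σ_X admB·Re 𝐁^{(j)}(X,U,A)| ≤ B₀·K₀(4·2^d, 2d)·#ring_j(s)`, `ring_j(s)` the anchor ring written out ([II] (1.26) discharged on the torus; the anchors by `exists_anchor_of_admB`).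
[cite: Balaban1988Convergent, (2.42) p.261, (2.47) p.264; Balaban1988RG2Cluster, (1.26) p.8] -/
theorem bScale_abs_le_ringCard_of_ineq242 (s : SeqOfRecord F θ.ν θ.τ9.M (gOfRecord₁₃ F N θ.toStage13Params p) p.K k)
    (t : Sect2.TermValues (F.P p.K) (MatA N) (FluctV N) θ.τ9.M) (a : Tk.SFluct (F.P p.K) (FluctV N)) (U : GaugeField (F.P p.K) 0 (SU N)) {j : ℕ}
    (h1 : 1 ≤ j) (hjk : j ≤ k) (hjm : j ≤ (F.P p.K).m + (F.P p.K).K) (hM : 1 ≤ θ.τ9.M) {κ B₀ : ℝ}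
    (hκ : kappa₀ (4 * 2 ^ (F.P p.K).d) (2 * (F.P p.K).d) ≤ κ) (hB₀ : 0 ≤ B₀)
    (h242 : ∀ X, Sect2.admB (F.P p.K) θ.ν θ.τ9.M (gOfRecord₁₃ F N θ.toStage13Params p) s.Ω s.Λ j (Sect2.domSites (F.P p.K) θ.τ9.M j X) = true →
      |(t.B j X (Sect2.ofBackgroundC (ιSU N) U) a).re| ≤ B₀ * Real.exp (-κ * (Sect2.domSys (F.P p.K) θ.τ9.M j).dj X)) :
    |∑ X : (Sect2.domSys (F.P p.K) θ.τ9.M j).Dom,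
        (if Sect2.admB (F.P p.K) θ.ν θ.τ9.M (gOfRecord₁₃ F N θ.toStage13Params p) s.Ω s.Λ j (Sect2.domSites (F.P p.K) θ.τ9.M j X) then
          (t.B j X (Sect2.ofBackgroundC (ιSU N) U) a).re else 0)| ≤
      B₀ * K₀ (4 * 2 ^ (F.P p.K).d) (2 * (F.P p.K).d) *
        ((univ.filter fun c : TPt (F.P p.K).d (Sect2.domCount (F.P p.K) θ.τ9.M j) =>
          (Sect2.domSites (F.P p.K) θ.τ9.M j (Sect2.cubeDom (F.P p.K) θ.τ9.M j c) ∩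
              Sect2.enlT (F.P p.K) (Sect2.zSide (F.P p.K) θ.ν θ.τ9.M (gOfRecord₁₃ F N θ.toStage13Params p) j) 1 (s.Λ j)ᶜ).Nonempty ∧
            ∃ c', (c' = c ∨ TAdj c' c) ∧ (Sect2.domSites (F.P p.K) θ.τ9.M j (Sect2.cubeDom (F.P p.K) θ.τ9.M j c') ∩ s.Ω j).Nonempty).card : ℝ) := by
  refine admSum_abs_le_ringCard (d := (F.P p.K).d) (Nc := Sect2.domCount (F.P p.K) θ.τ9.M j)
    (fun X => (t.B j X (Sect2.ofBackgroundC (ιSU N) U) a).re)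
    (fun X => Sect2.admB (F.P p.K) θ.ν θ.τ9.M (gOfRecord₁₃ F N θ.toStage13Params p) s.Ω s.Λ j (Sect2.domSites (F.P p.K) θ.τ9.M j X)) _ ?_ hκ hB₀ h242
  intro X hX
  obtain ⟨c, hc, hcE, hc'⟩ := exists_anchor_of_admB θ.ν (gOfRecord₁₃ F N θ.toStage13Params p) s.Ω s.Λ hjm hM (s.chain.Λ_subset j h1 hjk) X hX
  exact ⟨c, hc, Finset.mem_filter.2 ⟨Finset.mem_univ _, hcE, hc'⟩⟩

open Classical in
/-- **★★★ FILE 1's BINDER `h248` FROM (2.42) TERMWISE AT THE RECORD** ((2.48) «even more elementary», p. 263): for the history `s`, the witness `t`, the `S`-data `a`, the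
configuration `U`, `k ≤ m + K`, `1 ≤ M`: IF at every scale `j = 1,…,k` every `X` of the (2.41)(i) range obeys (2.42) `|Re 𝐁^{(j)}(X,(ιU,0),A)| ≤ B₀ e^{−κ d_j(X)}`
(`κ ≥ κ₀(4·2^d, 2d)`, `B₀ ≥ 0`) and the volumes dominate the anchor rings, `#ring_n(s) ≤ Γ_n` (`n = 1,…,k`), THEN
`|B240 (sect2TowerOfRecord … s t) (admB of record) a k U| ≤ 2·(B₀·K₀(4·2^d, 2d))·Σ_{n=1}^{k} Γ_n` — file 5's `h248_at_record₁₃CoPH_of_ineq247` with the DIAGONAL class map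
`cls j X := j`, `B₁ := B₀·K₀`, `V_n := #ring_n(s)`. [cite: Balaban1988Convergent, (2.42) p.261, (2.47)–(2.48) pp.263–264, (2.40)–(2.41) p.261; Balaban1988RG2Cluster, (1.26) p.8] -/
theorem h248_at_record₁₃CoPH_of_ineq242 (s : SeqOfRecord F θ.ν θ.τ9.M (gOfRecord₁₃ F N θ.toStage13Params p) p.K k)
    (t : Sect2.TermValues (F.P p.K) (MatA N) (FluctV N) θ.τ9.M) (a : Tk.SFluct (F.P p.K) (FluctV N)) (U : GaugeField (F.P p.K) 0 (SU N))
    (hk : k ≤ (F.P p.K).m + (F.P p.K).K) (hM : 1 ≤ θ.τ9.M) {κ B₀ : ℝ}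
    (hκ : kappa₀ (4 * 2 ^ (F.P p.K).d) (2 * (F.P p.K).d) ≤ κ) (hB₀ : 0 ≤ B₀)
    (h242 : ∀ j, 1 ≤ j → j ≤ k → ∀ X, Sect2.admB (F.P p.K) θ.ν θ.τ9.M (gOfRecord₁₃ F N θ.toStage13Params p) s.Ω s.Λ j (Sect2.domSites (F.P p.K) θ.τ9.M j X) = true →
      |(t.B j X (Sect2.ofBackgroundC (ιSU N) U) a).re| ≤ B₀ * Real.exp (-κ * (Sect2.domSys (F.P p.K) θ.τ9.M j).dj X))
    (Γ : ℕ → ℝ)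
    (hΓ : ∀ n, 1 ≤ n → n ≤ k →
      ((univ.filter fun c : TPt (F.P p.K).d (Sect2.domCount (F.P p.K) θ.τ9.M n) =>
          (Sect2.domSites (F.P p.K) θ.τ9.M n (Sect2.cubeDom (F.P p.K) θ.τ9.M n c) ∩
              Sect2.enlT (F.P p.K) (Sect2.zSide (F.P p.K) θ.ν θ.τ9.M (gOfRecord₁₃ F N θ.toStage13Params p) n) 1 (s.Λ n)ᶜ).Nonempty ∧
            ∃ c', (c' = c ∨ TAdj c' c) ∧ (Sect2.domSites (F.P p.K) θ.τ9.M n (Sect2.cubeDom (F.P p.K) θ.τ9.M n c') ∩ s.Ω n).Nonempty).card : ℝ) ≤ Γ n) :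
    |B240 (sect2TowerOfRecord F N (FluctV N) p.K (settingOfRecord₁₃ F N θ.toStage13Params p) (θ.rzAt p s) s t)
        (fun j X => Sect2.admB (F.P p.K) θ.ν θ.τ9.M (gOfRecord₁₃ F N θ.toStage13Params p) s.Ω s.Λ j (Sect2.domSites (F.P p.K) θ.τ9.M j X)) a k U| ≤
      2 * (B₀ * K₀ (4 * 2 ^ (F.P p.K).d) (2 * (F.P p.K).d)) * ∑ n ∈ Icc 1 k, Γ n := by
  have hBK : 0 ≤ B₀ * K₀ (4 * 2 ^ (F.P p.K).d) (2 * (F.P p.K).d) := mul_nonneg hB₀ (K₀_pos _ _).le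
  refine h248_at_record₁₃CoPH_of_ineq247 θ p s t a U (fun j _ => j) (fun j hj _ X _ => ⟨hj, le_rfl⟩) hBK
    (fun n => ((univ.filter fun c : TPt (F.P p.K).d (Sect2.domCount (F.P p.K) θ.τ9.M n) =>
          (Sect2.domSites (F.P p.K) θ.τ9.M n (Sect2.cubeDom (F.P p.K) θ.τ9.M n c) ∩
              Sect2.enlT (F.P p.K) (Sect2.zSide (F.P p.K) θ.ν θ.τ9.M (gOfRecord₁₃ F N θ.toStage13Params p) n) 1 (s.Λ n)ᶜ).Nonempty ∧
            ∃ c', (c' = c ∨ TAdj c' c) ∧ (Sect2.domSites (F.P p.K) θ.τ9.M n (Sect2.cubeDom (F.P p.K) θ.τ9.M n c') ∩ s.Ω n).Nonempty).card : ℝ))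
    Γ (fun n _ _ => Nat.cast_nonneg _) hΓ ?_
  intro n j hn hnj hjk
  by_cases hjn : j = n
  · subst hjn
    have h := bScale_abs_le_ringCard_of_ineq242 θ p s t a U hn hjk (hjk.trans hk) hM hκ hB₀ (h242 j hn hjk)
    have h2 : (2 : ℝ) ^ (-((j : ℝ) - j)) = 1 := by rw [sub_self, neg_zero, Real.rpow_zero]
    rw [h2, mul_one]
    refine le_of_eq_of_le ?_ h
    congr 1
    refine Finset.sum_congr rfl fun X _ => ?_
    simp only [and_true]
  · have h0 : ∑ X : (Sect2.domSys (F.P p.K) θ.τ9.M j).Dom,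
        (if Sect2.admB (F.P p.K) θ.ν θ.τ9.M (gOfRecord₁₃ F N θ.toStage13Params p) s.Ω s.Λ j (Sect2.domSites (F.P p.K) θ.τ9.M j X) = true ∧ j = n then
          (t.B j X (Sect2.ofBackgroundC (ιSU N) U) a).re else 0) = 0 :=
      Finset.sum_eq_zero fun X _ => by rw [if_neg (fun h => hjn h.2)]
    rw [h0, abs_zero]
    exact mul_nonneg (mul_nonneg hBK (Real.rpow_pos_of_pos two_pos _).le) (Nat.cast_nonneg _)

end AtRecord13

end Summit.QuantumFields.YangMills.Theorems.BalabanUVNodesN11Thm2BSideOfIneq242AtRecord13CoPH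

end
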